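import Summits.QuantumFields.YangMills.Theorems.BalabanUVNodesN15CovariantTwoGridStaircaseCellFit
import HarnessLib

/-!
# N15 = NE2, road (c) — PROGRAMME (PC), (PC-E): THE THIRD COARSE LETTER UNDER THE COVARIANT PAIRING — the second differences of the coarse transformed bond variables (straight fine
# holonomies in the induced gauge) from the fine step and second-difference letters: `‖Δ_κΔ_νV_μ‖ ≤ L^m·δ₂ + (L^m)²·δ_κδ_ν`, i.e. `η³(c + ηq²)` from the fine `η′²q`, `η′³c` — the datum
# class of n15-c∕360 is STABLE under the pairing, so the two-grid step can be iterated across scales (dag-n15-c g33, n15-c∕366)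

Cell `pub-ymgap`, seat `pub-ymgap-dag-n15-c` (generation g33; R134 (a) seat; HUMAN RULING D-0062; chair R424 venue).  `bears_on: R4∕N15 · K3⁸ SpineGivenEndpointR13SepCoPHV
(stmt-QuantumFields-27366)`; filed `--kind proof --supports stmt-QuantumFields-27366 --as helper` — COUNT-NEUTRAL.  Theorems only, 0 `def`, 0 `sorry`.  Imports BY NAME n15-c∕349
`…CovariantTwoGridStaircaseCellFit` (`norm_mprod_sub_mprod_le_of_unitary`; through it n15-c∕341 `gauged_lineHol_eq_mprod`, `kingSec_add_unitVec`, `norm_chain_sub_le`, `mprod`, `norm_unitary_mul_eq`,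
`conjTranspose_mprod_mul_self`, dag-n15-w2 `uN_gaugeTransformed_bond_unitary`).  Nothing in the tree is modified, no landed name re-declared.

WHY.  n15-c∕341 produced the first two COARSE letters (`‖V − 1‖`, `‖Δ_μV‖`) of the straight fine holonomy `V_μ(x) = Π_{t<L^m}V′_μ(σx + te′_μ)` from the fine letters; the (PC-E-A) chain
(n15-c∕356–364) now carries a THIRD letter (second differences).  For the two-grid step to be ITERABLE (η′ → η → Lη → …) the third letter must propagate too.  It does:
* §1 ★★ `norm_mprod_mixedDiff_le_of_unitary` — for four families of unitary factors `a_t, b_t, c_t, d_t` (`t < N`) with `‖a_t − b_t‖, ‖c_t − d_t‖ ≤ δ_ν`, `‖a_t − c_t‖, ‖b_t − d_t‖ ≤ δ_κ`,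
  `‖a_t − b_t − c_t + d_t‖ ≤ δ₂`:  `‖Πa − Πb − Πc + Πd‖ ≤ Nδ₂ + N²δ_κδ_ν` (the recursion `M_{n+1} = M_na_n + Π_n(d)(a_n−b_n−c_n+d_n) + (Π_n(b)−Π_n(d))(a_n−b_n) + (Π_n(c)−Π_n(d))(a_n−c_n)`);
  ★ `norm_mixedDiff_le_of_steps` (`‖f(p+Nu+Nv) − f(p+Nu) − f(p+Nv) + f(p)‖ ≤ N²δ` from the unit mixed differences, double telescoping by two chain bounds).
* §2 (King tori `M L k m`) ★★★ `norm_gauged_lineHol_mixedDiff_le` — in the induced gauge `u′∘σ` the coarse transformed bond variable of the straight holonomy satisfies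
  `‖V_μ(x+e_κ+e_ν) − V_μ(x+e_ν) − V_μ(x+e_κ) + V_μ(x)‖ ≤ L^m·δ₂ + (L^m)²·δ_κδ_ν` given, along the fine line over `x`, the `L^m`-step differences `δ_κ, δ_ν` and mixed differences `δ₂` of
  the transformed fine bond variables (`σ(x+e_κ) = σx + L^m e′_κ`); ★★★ `norm_gauged_lineHol_mixedDiff_le_of_stepLetters` — the same from the UNIT-step letters `b` (all directions) and `c₂`
  (unit mixed second differences) on a set containing the fine patch `σx + te′_μ + se′_κ + s′e′_ν` (`t < L^m`, `s, s′ ≤ L^m`): `≤ (L^m)³c₂ + (L^m)⁴b²` — at `b = η′²q`, `c₂ = η′³c`,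
  `L^mη′ = η` this is `η³(c + ηq²)`: THE THIRD COARSE LETTER, same shape as the fine one.

HONEST FRAMING ∕ LIMITS.  Finite-dimensional bookkeeping over DISPLAYED letters (the third letter is the datum of n15-c∕360: (3.35) + the Lipschitz clause of [Balaban1985Variational] Thm 1 (9),
own constant); nothing of [B9]∕[B11] asserted.  NE2⁺ NOT PRINTED ∕ NOT proved; N15 of record untouched; K3⁸ OPEN; counts of record UNMOVED (typed 28∕28 · discharged 8∕27); one finite 𝕋⁴ at
fixed ε per index — NOT infinite volume, NOT OS on ℝ⁴, NOT a mass gap, NOT Clay.  Restate-immune (no Theses import).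
-/

set_option autoImplicit false

noncomputable section

open scoped BigOperators Matrix Matrix.Norms.L2Operator
open Finset

namespace Summit.QuantumFields.YangMills.BalabanUVNodes.N15.CovAvg

open Literature.MathematicalPhysics.QuantumFieldTheory.Balaban1983to89
open Literature.MathematicalPhysics.QuantumFieldTheory.Balaban1983to89.B5Prop11Plancherel (Tor fine unitVec)
open Summit.QuantumFields.YangMills.BalabanUVNodes.N15.CurvedSpecies (uN_gaugeTransformed_bond_unitary)

variable {d : ℕ}

/-! ## §1 Mixed differences of ordered products of unitary factors; double telescoping -/

section Algebra

variable {mm : Type} [Fintype mm] [DecidableEq mm]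

/-- ★★ **THE MIXED SECOND DIFFERENCE OF ORDERED PRODUCTS OF UNITARY FACTORS**: four families `a, b, c, d` of unitary factors with `‖a_t − b_t‖, ‖c_t − d_t‖ ≤ δ_ν`,
`‖a_t − c_t‖, ‖b_t − d_t‖ ≤ δ_κ` and `‖a_t − b_t − c_t + d_t‖ ≤ δ₂` for `t < N` satisfy `‖Πa − Πb − Πc + Πd‖ ≤ Nδ₂ + N²δ_κδ_ν` (operator norm). [folklore] -/
theorem norm_mprod_mixedDiff_le_of_unitary {a b c dd : ℕ → Matrix mm mm ℂ} {N : ℕ} (ha : ∀ t < N, (a t)ᴴ * a t = 1) (hb : ∀ t < N, (b t)ᴴ * b t = 1)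
    (hc : ∀ t < N, (c t)ᴴ * c t = 1) (hd : ∀ t < N, (dd t)ᴴ * dd t = 1) {δκ δν δ₂ : ℝ} (hδκ : 0 ≤ δκ) (hδν : 0 ≤ δν)
    (hab : ∀ t < N, ‖a t - b t‖ ≤ δν) (hcd : ∀ t < N, ‖c t - dd t‖ ≤ δν) (hac : ∀ t < N, ‖a t - c t‖ ≤ δκ) (hbd : ∀ t < N, ‖b t - dd t‖ ≤ δκ)
    (h₂ : ∀ t < N, ‖a t - b t - c t + dd t‖ ≤ δ₂) :
    ‖mprod a N - mprod b N - mprod c N + mprod dd N‖ ≤ N * δ₂ + (N : ℝ) ^ 2 * (δκ * δν) := by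
  induction N with
  | zero => simp
  | succ N ih =>
      have hlt : ∀ t, t < N → t < N + 1 := fun t ht => Nat.lt_succ_of_lt ht
      have ih' := ih (fun t ht => ha t (hlt t ht)) (fun t ht => hb t (hlt t ht)) (fun t ht => hc t (hlt t ht)) (fun t ht => hd t (hlt t ht))
        (fun t ht => hab t (hlt t ht)) (fun t ht => hcd t (hlt t ht)) (fun t ht => hac t (hlt t ht)) (fun t ht => hbd t (hlt t ht)) (fun t ht => h₂ t (hlt t ht))
      have hN := Nat.lt_succ_self N
      rw [mprod_succ, mprod_succ, mprod_succ, mprod_succ]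
      have hid : mprod a N * a N - mprod b N * b N - mprod c N * c N + mprod dd N * dd N =
          (mprod a N - mprod b N - mprod c N + mprod dd N) * a N + mprod dd N * (a N - b N - c N + dd N) +
            (mprod b N - mprod dd N) * (a N - b N) + (mprod c N - mprod dd N) * (a N - c N) := by noncomm_ring
      rw [hid]
      have hPb : ‖mprod b N - mprod dd N‖ ≤ N * δκ := by
        refine (norm_mprod_sub_mprod_le_of_unitary (fun t ht => hb t (hlt t ht)) (fun t ht => hd t (hlt t ht))).trans ?_
        calc ∑ i ∈ range N, ‖b i - dd i‖ ≤ ∑ _i ∈ range N, δκ := Finset.sum_le_sum fun i hi => hbd i (hlt i (Finset.mem_range.mp hi))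
          _ = N * δκ := by rw [Finset.sum_const, Finset.card_range, nsmul_eq_mul]
      have hPc : ‖mprod c N - mprod dd N‖ ≤ N * δν := by
        refine (norm_mprod_sub_mprod_le_of_unitary (fun t ht => hc t (hlt t ht)) (fun t ht => hd t (hlt t ht))).trans ?_
        calc ∑ i ∈ range N, ‖c i - dd i‖ ≤ ∑ _i ∈ range N, δν := Finset.sum_le_sum fun i hi => hcd i (hlt i (Finset.mem_range.mp hi))
          _ = N * δν := by rw [Finset.sum_const, Finset.card_range, nsmul_eq_mul]
      have hdu : (mprod dd N)ᴴ * mprod dd N = 1 := conjTranspose_mprod_mul_self fun t ht => hd t (hlt t ht)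
      calc ‖(mprod a N - mprod b N - mprod c N + mprod dd N) * a N + mprod dd N * (a N - b N - c N + dd N) +
            (mprod b N - mprod dd N) * (a N - b N) + (mprod c N - mprod dd N) * (a N - c N)‖
          ≤ ‖(mprod a N - mprod b N - mprod c N + mprod dd N) * a N‖ + ‖mprod dd N * (a N - b N - c N + dd N)‖ +
            ‖(mprod b N - mprod dd N) * (a N - b N)‖ + ‖(mprod c N - mprod dd N) * (a N - c N)‖ :=
            (norm_add_le _ _).trans (add_le_add ((norm_add_le _ _).trans (add_le_add (norm_add_le _ _) le_rfl)) le_rfl)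
        _ ≤ (N * δ₂ + (N : ℝ) ^ 2 * (δκ * δν)) + δ₂ + (N * δκ) * δν + (N * δν) * δκ := by
            rw [norm_mul_unitary_eq (ha N hN), norm_unitary_mul_eq hdu]
            exact add_le_add (add_le_add (add_le_add ih' (h₂ N hN)) ((norm_mul_le _ _).trans (mul_le_mul hPb (hab N hN) (norm_nonneg _) (by positivity))))
              ((norm_mul_le _ _).trans (mul_le_mul hPc (hac N hN) (norm_nonneg _) (by positivity)))
        _ ≤ ((N + 1 : ℕ) : ℝ) * δ₂ + ((N + 1 : ℕ) : ℝ) ^ 2 * (δκ * δν) := by push_cast; nlinarith [mul_nonneg hδκ hδν]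

/-- ★ DOUBLE TELESCOPING OF A MIXED DIFFERENCE: `‖f(p + N•u + N•v) − f(p + N•u) − f(p + N•v) + f(p)‖ ≤ N²·δ` when every unit mixed difference
`‖f(q + u + v) − f(q + u) − f(q + v) + f(q)‖` at the points `q = p + s•u + s′•v` (`s, s′ < N`) is `≤ δ` (two chain bounds, n15-c∕341 `norm_chain_sub_le`). [folklore] -/
theorem norm_mixedDiff_le_of_steps {X E : Type} [AddCommGroup X] [SeminormedAddCommGroup E] (f : X → E) (p u v : X) {δ : ℝ} {N : ℕ}
    (h : ∀ s < N, ∀ s' < N, ‖f (p + s • u + s' • v + u + v) - f (p + s • u + s' • v + u) - f (p + s • u + s' • v + v) + f (p + s • u + s' • v)‖ ≤ δ) :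
    ‖f (p + N • u + N • v) - f (p + N • u) - f (p + N • v) + f p‖ ≤ (N : ℝ) ^ 2 * δ := by
  -- outer chain in `s` for `g s := f (p + s•u + N•v) − f (p + s•u)`
  have hg := norm_chain_sub_le (fun s : ℕ => f (p + s • u + N • v) - f (p + s • u)) (N := N) (κ := N * δ) (fun s hs => by
    -- inner chain in `s′` for `h s′ := f (p + (s+1)•u + s′•v) − f (p + s•u + s′•v)`
    have hh := norm_chain_sub_le (fun s' : ℕ => f (p + (s + 1) • u + s' • v) - f (p + s • u + s' • v)) (N := N) (κ := δ) (fun s' hs' => by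
      have e1 : p + (s + 1) • u + (s' + 1) • v = p + s • u + s' • v + u + v := by rw [succ_nsmul, succ_nsmul]; abel
      have e2 : p + s • u + (s' + 1) • v = p + s • u + s' • v + v := by rw [succ_nsmul]; abel
      have e3 : p + (s + 1) • u + s' • v = p + s • u + s' • v + u := by rw [succ_nsmul]; abel
      have hx := h s hs s' hs'
      rw [e1, e2, e3]
      have e4 : f (p + s • u + s' • v + u) - f (p + s • u + s' • v) - (f (p + s • u + s' • v + u + v) - f (p + s • u + s' • v + v)) =
          -(f (p + s • u + s' • v + u + v) - f (p + s • u + s' • v + u) - f (p + s • u + s' • v + v) + f (p + s • u + s' • v)) := by abel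
      rw [e4, norm_neg]; exact hx)
    simp only [zero_smul, add_zero] at hh
    have e5 : f (p + s • u + N • v) - f (p + s • u) - (f (p + (s + 1) • u + N • v) - f (p + (s + 1) • u)) =
        f (p + (s + 1) • u) - f (p + s • u) - (f (p + (s + 1) • u + N • v) - f (p + s • u + N • v)) := by abel
    rw [e5]; exact hh)
  simp only [zero_smul, add_zero] at hg
  have e6 : f (p + N • u + N • v) - f (p + N • u) - f (p + N • v) + f p = -(f (p + N • v) - f p - (f (p + N • u + N • v) - f (p + N • u))) := by abel
  rw [e6, norm_neg]
  refine hg.trans (le_of_eq ?_)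
  ring

end Algebra

/-! ## §2 The third coarse letter: second differences of the straight holonomy in the induced gauge -/

section Pairing

variable (M : Fin (d + 1) → ℕ) [∀ μ, NeZero (M μ)] (L k m : ℕ) [NeZero L] {mm : Type} [Fintype mm] [DecidableEq mm]

/-- ★★★ **THE THIRD COARSE LETTER FROM `L^m`-STEP LETTERS ALONG THE LINE**: in the induced gauge `u′∘σ`, the coarse transformed bond variable
`V_μ(x) = u′(σx)·(Π_{t<L^m}U′_μ(σx + te′_μ))·u′(σ(x+e_μ))ᴴ` satisfies `‖V_μ(x+e_κ+e_ν) − V_μ(x+e_ν) − V_μ(x+e_κ) + V_μ(x)‖ ≤ L^m·δ₂ + (L^m)²·δ_κδ_ν` whenever, at every point `p_t = σx + te′_μ`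
of the fine line, the transformed fine bond variables `V′(p) = u′(p)U′_μ(p)u′(p+e′_μ)ᴴ` obey `‖V′(p_t + L^me′_κ + L^me′_ν) − V′(p_t + L^me′_κ) − V′(p_t + L^me′_ν) + V′(p_t)‖ ≤ δ₂` and the
`L^m`-step differences `δ_κ` (in `e′_κ`, at `p_t` and `p_t + L^me′_ν`) and `δ_ν` (in `e′_ν`, at `p_t` and `p_t + L^me′_κ`) — `σ(x + e_κ) = σx + L^me′_κ` (n15-c∕341) makes the four coarse
variables ordered products of the four shifted fine families. [cite: Balaban1985Averaging, (124)–(126) p.36 (the straight holonomy: shape); Balaban1985Variational, Thm 1 (9) p.279 (the letter carried)] -/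
theorem norm_gauged_lineHol_mixedDiff_le {u' : Tor (fine (L ^ m * L ^ k) M) → Matrix mm mm ℂ} (hu' : ∀ z, (u' z)ᴴ * u' z = 1)
    {U' : Fin (d + 1) → Tor (fine (L ^ m * L ^ k) M) → Matrix mm mm ℂ} (hU' : ∀ μ z, (U' μ z)ᴴ * U' μ z = 1) {δκ δν δ₂ : ℝ} (hδκ : 0 ≤ δκ) (hδν : 0 ≤ δν)
    (μ κ' ν' : Fin (d + 1)) (x : Tor (fine (L ^ k) M))
    (hline : ∀ t < L ^ m,
      ‖u' (kingSec M L k m x + t • unitVec (fine (L ^ m * L ^ k) M) μ + (L ^ m) • unitVec (fine (L ^ m * L ^ k) M) κ' + (L ^ m) • unitVec (fine (L ^ m * L ^ k) M) ν') *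
            U' μ (kingSec M L k m x + t • unitVec (fine (L ^ m * L ^ k) M) μ + (L ^ m) • unitVec (fine (L ^ m * L ^ k) M) κ' + (L ^ m) • unitVec (fine (L ^ m * L ^ k) M) ν') *
            (u' (kingSec M L k m x + t • unitVec (fine (L ^ m * L ^ k) M) μ + (L ^ m) • unitVec (fine (L ^ m * L ^ k) M) κ' + (L ^ m) • unitVec (fine (L ^ m * L ^ k) M) ν' + unitVec (fine (L ^ m * L ^ k) M) μ))ᴴ -
          u' (kingSec M L k m x + t • unitVec (fine (L ^ m * L ^ k) M) μ + (L ^ m) • unitVec (fine (L ^ m * L ^ k) M) κ') *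
            U' μ (kingSec M L k m x + t • unitVec (fine (L ^ m * L ^ k) M) μ + (L ^ m) • unitVec (fine (L ^ m * L ^ k) M) κ') *
            (u' (kingSec M L k m x + t • unitVec (fine (L ^ m * L ^ k) M) μ + (L ^ m) • unitVec (fine (L ^ m * L ^ k) M) κ' + unitVec (fine (L ^ m * L ^ k) M) μ))ᴴ‖ ≤ δν ∧
      ‖u' (kingSec M L k m x + t • unitVec (fine (L ^ m * L ^ k) M) μ + (L ^ m) • unitVec (fine (L ^ m * L ^ k) M) ν') *
            U' μ (kingSec M L k m x + t • unitVec (fine (L ^ m * L ^ k) M) μ + (L ^ m) • unitVec (fine (L ^ m * L ^ k) M) ν') *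
            (u' (kingSec M L k m x + t • unitVec (fine (L ^ m * L ^ k) M) μ + (L ^ m) • unitVec (fine (L ^ m * L ^ k) M) ν' + unitVec (fine (L ^ m * L ^ k) M) μ))ᴴ -
          u' (kingSec M L k m x + t • unitVec (fine (L ^ m * L ^ k) M) μ) * U' μ (kingSec M L k m x + t • unitVec (fine (L ^ m * L ^ k) M) μ) *
            (u' (kingSec M L k m x + t • unitVec (fine (L ^ m * L ^ k) M) μ + unitVec (fine (L ^ m * L ^ k) M) μ))ᴴ‖ ≤ δν ∧
      ‖u' (kingSec M L k m x + t • unitVec (fine (L ^ m * L ^ k) M) μ + (L ^ m) • unitVec (fine (L ^ m * L ^ k) M) κ' + (L ^ m) • unitVec (fine (L ^ m * L ^ k) M) ν') *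
            U' μ (kingSec M L k m x + t • unitVec (fine (L ^ m * L ^ k) M) μ + (L ^ m) • unitVec (fine (L ^ m * L ^ k) M) κ' + (L ^ m) • unitVec (fine (L ^ m * L ^ k) M) ν') *
            (u' (kingSec M L k m x + t • unitVec (fine (L ^ m * L ^ k) M) μ + (L ^ m) • unitVec (fine (L ^ m * L ^ k) M) κ' + (L ^ m) • unitVec (fine (L ^ m * L ^ k) M) ν' + unitVec (fine (L ^ m * L ^ k) M) μ))ᴴ -
          u' (kingSec M L k m x + t • unitVec (fine (L ^ m * L ^ k) M) μ + (L ^ m) • unitVec (fine (L ^ m * L ^ k) M) ν') *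
            U' μ (kingSec M L k m x + t • unitVec (fine (L ^ m * L ^ k) M) μ + (L ^ m) • unitVec (fine (L ^ m * L ^ k) M) ν') *
            (u' (kingSec M L k m x + t • unitVec (fine (L ^ m * L ^ k) M) μ + (L ^ m) • unitVec (fine (L ^ m * L ^ k) M) ν' + unitVec (fine (L ^ m * L ^ k) M) μ))ᴴ‖ ≤ δκ ∧
      ‖u' (kingSec M L k m x + t • unitVec (fine (L ^ m * L ^ k) M) μ + (L ^ m) • unitVec (fine (L ^ m * L ^ k) M) κ') *
            U' μ (kingSec M L k m x + t • unitVec (fine (L ^ m * L ^ k) M) μ + (L ^ m) • unitVec (fine (L ^ m * L ^ k) M) κ') *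
            (u' (kingSec M L k m x + t • unitVec (fine (L ^ m * L ^ k) M) μ + (L ^ m) • unitVec (fine (L ^ m * L ^ k) M) κ' + unitVec (fine (L ^ m * L ^ k) M) μ))ᴴ -
          u' (kingSec M L k m x + t • unitVec (fine (L ^ m * L ^ k) M) μ) * U' μ (kingSec M L k m x + t • unitVec (fine (L ^ m * L ^ k) M) μ) *
            (u' (kingSec M L k m x + t • unitVec (fine (L ^ m * L ^ k) M) μ + unitVec (fine (L ^ m * L ^ k) M) μ))ᴴ‖ ≤ δκ ∧
      ‖u' (kingSec M L k m x + t • unitVec (fine (L ^ m * L ^ k) M) μ + (L ^ m) • unitVec (fine (L ^ m * L ^ k) M) κ' + (L ^ m) • unitVec (fine (L ^ m * L ^ k) M) ν') *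
            U' μ (kingSec M L k m x + t • unitVec (fine (L ^ m * L ^ k) M) μ + (L ^ m) • unitVec (fine (L ^ m * L ^ k) M) κ' + (L ^ m) • unitVec (fine (L ^ m * L ^ k) M) ν') *
            (u' (kingSec M L k m x + t • unitVec (fine (L ^ m * L ^ k) M) μ + (L ^ m) • unitVec (fine (L ^ m * L ^ k) M) κ' + (L ^ m) • unitVec (fine (L ^ m * L ^ k) M) ν' + unitVec (fine (L ^ m * L ^ k) M) μ))ᴴ -
          u' (kingSec M L k m x + t • unitVec (fine (L ^ m * L ^ k) M) μ + (L ^ m) • unitVec (fine (L ^ m * L ^ k) M) κ') *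
            U' μ (kingSec M L k m x + t • unitVec (fine (L ^ m * L ^ k) M) μ + (L ^ m) • unitVec (fine (L ^ m * L ^ k) M) κ') *
            (u' (kingSec M L k m x + t • unitVec (fine (L ^ m * L ^ k) M) μ + (L ^ m) • unitVec (fine (L ^ m * L ^ k) M) κ' + unitVec (fine (L ^ m * L ^ k) M) μ))ᴴ -
          u' (kingSec M L k m x + t • unitVec (fine (L ^ m * L ^ k) M) μ + (L ^ m) • unitVec (fine (L ^ m * L ^ k) M) ν') *
            U' μ (kingSec M L k m x + t • unitVec (fine (L ^ m * L ^ k) M) μ + (L ^ m) • unitVec (fine (L ^ m * L ^ k) M) ν') *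
            (u' (kingSec M L k m x + t • unitVec (fine (L ^ m * L ^ k) M) μ + (L ^ m) • unitVec (fine (L ^ m * L ^ k) M) ν' + unitVec (fine (L ^ m * L ^ k) M) μ))ᴴ +
          u' (kingSec M L k m x + t • unitVec (fine (L ^ m * L ^ k) M) μ) * U' μ (kingSec M L k m x + t • unitVec (fine (L ^ m * L ^ k) M) μ) *
            (u' (kingSec M L k m x + t • unitVec (fine (L ^ m * L ^ k) M) μ + unitVec (fine (L ^ m * L ^ k) M) μ))ᴴ‖ ≤ δ₂) :
    ‖u' (kingSec M L k m (x + unitVec (fine (L ^ k) M) κ' + unitVec (fine (L ^ k) M) ν')) *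
          mprod (fun t => U' μ (kingSec M L k m (x + unitVec (fine (L ^ k) M) κ' + unitVec (fine (L ^ k) M) ν') + t • unitVec (fine (L ^ m * L ^ k) M) μ)) (L ^ m) *
          (u' (kingSec M L k m (x + unitVec (fine (L ^ k) M) κ' + unitVec (fine (L ^ k) M) ν' + unitVec (fine (L ^ k) M) μ)))ᴴ -
        u' (kingSec M L k m (x + unitVec (fine (L ^ k) M) κ')) * mprod (fun t => U' μ (kingSec M L k m (x + unitVec (fine (L ^ k) M) κ') + t • unitVec (fine (L ^ m * L ^ k) M) μ)) (L ^ m) *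
          (u' (kingSec M L k m (x + unitVec (fine (L ^ k) M) κ' + unitVec (fine (L ^ k) M) μ)))ᴴ -
        u' (kingSec M L k m (x + unitVec (fine (L ^ k) M) ν')) * mprod (fun t => U' μ (kingSec M L k m (x + unitVec (fine (L ^ k) M) ν') + t • unitVec (fine (L ^ m * L ^ k) M) μ)) (L ^ m) *
          (u' (kingSec M L k m (x + unitVec (fine (L ^ k) M) ν' + unitVec (fine (L ^ k) M) μ)))ᴴ +
        u' (kingSec M L k m x) * mprod (fun t => U' μ (kingSec M L k m x + t • unitVec (fine (L ^ m * L ^ k) M) μ)) (L ^ m) * (u' (kingSec M L k m (x + unitVec (fine (L ^ k) M) μ)))ᴴ‖ ≤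
      (L ^ m : ℕ) * δ₂ + ((L ^ m : ℕ) : ℝ) ^ 2 * (δκ * δν) := by
  -- the four coarse variables are ordered products of the transformed fine bond variables along the four shifted lines
  rw [gauged_lineHol_eq_mprod M L k m hu' U' μ, gauged_lineHol_eq_mprod M L k m hu' U' μ, gauged_lineHol_eq_mprod M L k m hu' U' μ, gauged_lineHol_eq_mprod M L k m hu' U' μ]
  have hσ12 : kingSec M L k m (x + unitVec (fine (L ^ k) M) κ' + unitVec (fine (L ^ k) M) ν') = kingSec M L k m x + (L ^ m) • unitVec (fine (L ^ m * L ^ k) M) κ' + (L ^ m) • unitVec (fine (L ^ m * L ^ k) M) ν' := by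
    rw [kingSec_add_unitVec, kingSec_add_unitVec]
  have hσκ : kingSec M L k m (x + unitVec (fine (L ^ k) M) κ') = kingSec M L k m x + (L ^ m) • unitVec (fine (L ^ m * L ^ k) M) κ' := kingSec_add_unitVec M L k m x κ'
  have hσ2 : kingSec M L k m (x + unitVec (fine (L ^ k) M) ν') = kingSec M L k m x + (L ^ m) • unitVec (fine (L ^ m * L ^ k) M) ν' := kingSec_add_unitVec M L k m x ν'
  rw [hσ12, hσκ, hσ2]
  -- the point bookkeeping `(p + N e′_κ + N e′_ν) + t e′_μ = (p + t e′_μ) + N e′_κ + N e′_ν` etc.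
  have eA : ∀ t : ℕ, kingSec M L k m x + (L ^ m) • unitVec (fine (L ^ m * L ^ k) M) κ' + (L ^ m) • unitVec (fine (L ^ m * L ^ k) M) ν' + t • unitVec (fine (L ^ m * L ^ k) M) μ =
      kingSec M L k m x + t • unitVec (fine (L ^ m * L ^ k) M) μ + (L ^ m) • unitVec (fine (L ^ m * L ^ k) M) κ' + (L ^ m) • unitVec (fine (L ^ m * L ^ k) M) ν' := fun t => by abel
  have eB : ∀ t : ℕ, kingSec M L k m x + (L ^ m) • unitVec (fine (L ^ m * L ^ k) M) κ' + t • unitVec (fine (L ^ m * L ^ k) M) μ =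
      kingSec M L k m x + t • unitVec (fine (L ^ m * L ^ k) M) μ + (L ^ m) • unitVec (fine (L ^ m * L ^ k) M) κ' := fun t => by abel
  have eC : ∀ t : ℕ, kingSec M L k m x + (L ^ m) • unitVec (fine (L ^ m * L ^ k) M) ν' + t • unitVec (fine (L ^ m * L ^ k) M) μ =
      kingSec M L k m x + t • unitVec (fine (L ^ m * L ^ k) M) μ + (L ^ m) • unitVec (fine (L ^ m * L ^ k) M) ν' := fun t => by abel
  simp only [eA, eB, eC]
  have hWu : ∀ z, (u' z * U' μ z * (u' (z + unitVec (fine (L ^ m * L ^ k) M) μ))ᴴ)ᴴ * (u' z * U' μ z * (u' (z + unitVec (fine (L ^ m * L ^ k) M) μ))ᴴ) = 1 := fun z =>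
    uN_gaugeTransformed_bond_unitary (fun ν => Equiv.addRight (unitVec (fine (L ^ m * L ^ k) M) ν)) u' U' hu' hU' μ z
  exact norm_mprod_mixedDiff_le_of_unitary (fun t _ => hWu _) (fun t _ => hWu _) (fun t _ => hWu _) (fun t _ => hWu _) hδκ hδν
    (fun t ht => (hline t ht).1) (fun t ht => (hline t ht).2.1) (fun t ht => (hline t ht).2.2.1) (fun t ht => (hline t ht).2.2.2.1) (fun t ht => (hline t ht).2.2.2.2)

/-- ★★★ **THE THIRD COARSE LETTER FROM THE UNIT-STEP LETTERS** (the form the (PC-E) chain carries): with `V′(z) = u′(z)U′_μ(z)u′(z+e′_μ)ᴴ`, an all-direction step letter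
`‖V′(z+e′_ρ) − V′(z)‖ ≤ b` and a unit second-difference letter `‖V′(z+e′_ρ+e′_ρ′) − V′(z+e′_ρ′) − V′(z+e′_ρ) + V′(z)‖ ≤ c₂` at the points of the fine patch `σx + te′_μ + se′_κ + s′e′_ν`
(`t < L^m`, `s, s′ ≤ L^m`) give `‖V_μ(x+e_κ+e_ν) − V_μ(x+e_ν) − V_μ(x+e_κ) + V_μ(x)‖ ≤ (L^m)³c₂ + (L^m)⁴b²` for the straight holonomies in the induced gauge — at `b = η′²q`, `c₂ = η′³c`,
`L^mη′ = η`: `η³(c + ηq²)`, the fine letter's shape one scale up. [cite: Balaban1985Averaging, (124)–(126) p.36 (shape); Balaban1985Variational, Thm 1 (9) p.279 (the letter carried)] -/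
theorem norm_gauged_lineHol_mixedDiff_le_of_stepLetters {u' : Tor (fine (L ^ m * L ^ k) M) → Matrix mm mm ℂ} (hu' : ∀ z, (u' z)ᴴ * u' z = 1)
    {U' : Fin (d + 1) → Tor (fine (L ^ m * L ^ k) M) → Matrix mm mm ℂ} (hU' : ∀ μ z, (U' μ z)ᴴ * U' μ z = 1) {b c₂ : ℝ} (hb : 0 ≤ b)
    (μ κ' ν' : Fin (d + 1)) (x : Tor (fine (L ^ k) M)) {Qf : Set (Tor (fine (L ^ m * L ^ k) M))}
    (hQ : ∀ t < L ^ m, ∀ s ≤ L ^ m, ∀ s' ≤ L ^ m,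
      kingSec M L k m x + t • unitVec (fine (L ^ m * L ^ k) M) μ + s • unitVec (fine (L ^ m * L ^ k) M) κ' + s' • unitVec (fine (L ^ m * L ^ k) M) ν' ∈ Qf)
    (hstep : ∀ z ∈ Qf, ∀ ρ : Fin (d + 1), ‖u' (z + unitVec (fine (L ^ m * L ^ k) M) ρ) * U' μ (z + unitVec (fine (L ^ m * L ^ k) M) ρ) * (u' (z + unitVec (fine (L ^ m * L ^ k) M) ρ + unitVec (fine (L ^ m * L ^ k) M) μ))ᴴ -
      u' z * U' μ z * (u' (z + unitVec (fine (L ^ m * L ^ k) M) μ))ᴴ‖ ≤ b)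
    (hsecond : ∀ z ∈ Qf, ∀ ρ ρ' : Fin (d + 1),
      ‖u' (z + unitVec (fine (L ^ m * L ^ k) M) ρ + unitVec (fine (L ^ m * L ^ k) M) ρ') * U' μ (z + unitVec (fine (L ^ m * L ^ k) M) ρ + unitVec (fine (L ^ m * L ^ k) M) ρ') *
            (u' (z + unitVec (fine (L ^ m * L ^ k) M) ρ + unitVec (fine (L ^ m * L ^ k) M) ρ' + unitVec (fine (L ^ m * L ^ k) M) μ))ᴴ -
          u' (z + unitVec (fine (L ^ m * L ^ k) M) ρ) * U' μ (z + unitVec (fine (L ^ m * L ^ k) M) ρ) * (u' (z + unitVec (fine (L ^ m * L ^ k) M) ρ + unitVec (fine (L ^ m * L ^ k) M) μ))ᴴ -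
          u' (z + unitVec (fine (L ^ m * L ^ k) M) ρ') * U' μ (z + unitVec (fine (L ^ m * L ^ k) M) ρ') * (u' (z + unitVec (fine (L ^ m * L ^ k) M) ρ' + unitVec (fine (L ^ m * L ^ k) M) μ))ᴴ +
          u' z * U' μ z * (u' (z + unitVec (fine (L ^ m * L ^ k) M) μ))ᴴ‖ ≤ c₂) :
    ‖u' (kingSec M L k m (x + unitVec (fine (L ^ k) M) κ' + unitVec (fine (L ^ k) M) ν')) *
          mprod (fun t => U' μ (kingSec M L k m (x + unitVec (fine (L ^ k) M) κ' + unitVec (fine (L ^ k) M) ν') + t • unitVec (fine (L ^ m * L ^ k) M) μ)) (L ^ m) *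
          (u' (kingSec M L k m (x + unitVec (fine (L ^ k) M) κ' + unitVec (fine (L ^ k) M) ν' + unitVec (fine (L ^ k) M) μ)))ᴴ -
        u' (kingSec M L k m (x + unitVec (fine (L ^ k) M) κ')) * mprod (fun t => U' μ (kingSec M L k m (x + unitVec (fine (L ^ k) M) κ') + t • unitVec (fine (L ^ m * L ^ k) M) μ)) (L ^ m) *
          (u' (kingSec M L k m (x + unitVec (fine (L ^ k) M) κ' + unitVec (fine (L ^ k) M) μ)))ᴴ -
        u' (kingSec M L k m (x + unitVec (fine (L ^ k) M) ν')) * mprod (fun t => U' μ (kingSec M L k m (x + unitVec (fine (L ^ k) M) ν') + t • unitVec (fine (L ^ m * L ^ k) M) μ)) (L ^ m) *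
          (u' (kingSec M L k m (x + unitVec (fine (L ^ k) M) ν' + unitVec (fine (L ^ k) M) μ)))ᴴ +
        u' (kingSec M L k m x) * mprod (fun t => U' μ (kingSec M L k m x + t • unitVec (fine (L ^ m * L ^ k) M) μ)) (L ^ m) * (u' (kingSec M L k m (x + unitVec (fine (L ^ k) M) μ)))ᴴ‖ ≤
      ((L ^ m : ℕ) : ℝ) ^ 3 * c₂ + ((L ^ m : ℕ) : ℝ) ^ 4 * b ^ 2 := by
  have hN0 : (0 : ℝ) ≤ ((L ^ m : ℕ) : ℝ) := Nat.cast_nonneg _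
  -- the chains along the patch (direction `ν′` at fixed `s`, direction `κ′` at fixed `s′`)
  have chainν : ∀ t < L ^ m, ∀ s ≤ L ^ m, ‖u' (kingSec M L k m x + t • unitVec (fine (L ^ m * L ^ k) M) μ + s • unitVec (fine (L ^ m * L ^ k) M) κ' + (L ^ m) • unitVec (fine (L ^ m * L ^ k) M) ν') * U' μ (kingSec M L k m x + t • unitVec (fine (L ^ m * L ^ k) M) μ + s • unitVec (fine (L ^ m * L ^ k) M) κ' + (L ^ m) • unitVec (fine (L ^ m * L ^ k) M) ν') * (u' (kingSec M L k m x + t • unitVec (fine (L ^ m * L ^ k) M) μ + s • unitVec (fine (L ^ m * L ^ k) M) κ' + (L ^ m) • unitVec (fine (L ^ m * L ^ k) M) ν' + unitVec (fine (L ^ m * L ^ k) M) μ))ᴴ -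
      u' (kingSec M L k m x + t • unitVec (fine (L ^ m * L ^ k) M) μ + s • unitVec (fine (L ^ m * L ^ k) M) κ') * U' μ (kingSec M L k m x + t • unitVec (fine (L ^ m * L ^ k) M) μ + s • unitVec (fine (L ^ m * L ^ k) M) κ') * (u' (kingSec M L k m x + t • unitVec (fine (L ^ m * L ^ k) M) μ + s • unitVec (fine (L ^ m * L ^ k) M) κ' + unitVec (fine (L ^ m * L ^ k) M) μ))ᴴ‖ ≤ (L ^ m : ℕ) * b := fun t ht s hs => by
    have h := norm_chain_sub_le (fun s' : ℕ => u' (kingSec M L k m x + t • unitVec (fine (L ^ m * L ^ k) M) μ + s • unitVec (fine (L ^ m * L ^ k) M) κ' + s' • unitVec (fine (L ^ m * L ^ k) M) ν') * U' μ (kingSec M L k m x + t • unitVec (fine (L ^ m * L ^ k) M) μ + s • unitVec (fine (L ^ m * L ^ k) M) κ' + s' • unitVec (fine (L ^ m * L ^ k) M) ν') * (u' (kingSec M L k m x + t • unitVec (fine (L ^ m * L ^ k) M) μ + s • unitVec (fine (L ^ m * L ^ k) M) κ' + s' • unitVec (fine (L ^ m * L ^ k) M) ν' + unitVec (fine (L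 ^ m * L ^ k) M) μ))ᴴ) (N := L ^ m) (κ := b) (fun s' hs' => by
      rw [norm_sub_rev, succ_nsmul, ← add_assoc]; exact hstep _ (hQ t ht s hs s' hs'.le) ν')
    simp only [zero_smul, add_zero] at h
    rw [norm_sub_rev]; exact h
  have chainκ : ∀ t < L ^ m, ∀ s' ≤ L ^ m, ‖u' (kingSec M L k m x + t • unitVec (fine (L ^ m * L ^ k) M) μ + (L ^ m) • unitVec (fine (L ^ m * L ^ k) M) κ' + s' • unitVec (fine (L ^ m * L ^ k) M) ν') * U' μ (kingSec M L k m x + t • unitVec (fine (L ^ m * L ^ k) M) μ + (L ^ m) • unitVec (fine (L ^ m * L ^ k) M) κ' + s' • unitVec (fine (L ^ m * L ^ k) M) ν') * (u' (kingSec M L k m x + t • unitVec (fine (L ^ m * L ^ k) M) μ + (L ^ m) • unitVec (fine (L ^ m * L ^ k) M) κ' + s' • unitVec (fine (L ^ m * L ^ k) M) ν' + unitVec (fine (L ^ m * L ^ k) M) μ))ᴴ -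
      u' (kingSec M L k m x + t • unitVec (fine (L ^ m * L ^ k) M) μ + 0 • unitVec (fine (L ^ m * L ^ k) M) κ' + s' • unitVec (fine (L ^ m * L ^ k) M) ν') * U' μ (kingSec M L k m x + t • unitVec (fine (L ^ m * L ^ k) M) μ + 0 • unitVec (fine (L ^ m * L ^ k) M) κ' + s' • unitVec (fine (L ^ m * L ^ k) M) ν') * (u' (kingSec M L k m x + t • unitVec (fine (L ^ m * L ^ k) M) μ + 0 • unitVec (fine (L ^ m * L ^ k) M) κ' + s' • unitVec (fine (L ^ m * L ^ k) M) ν' + unitVec (fine (L ^ m * L ^ k) M) μ))ᴴ‖ ≤ (L ^ m : ℕ) * b := fun t ht s' hs' => by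
    have h := norm_chain_sub_le (fun s : ℕ => u' (kingSec M L k m x + t • unitVec (fine (L ^ m * L ^ k) M) μ + s • unitVec (fine (L ^ m * L ^ k) M) κ' + s' • unitVec (fine (L ^ m * L ^ k) M) ν') * U' μ (kingSec M L k m x + t • unitVec (fine (L ^ m * L ^ k) M) μ + s • unitVec (fine (L ^ m * L ^ k) M) κ' + s' • unitVec (fine (L ^ m * L ^ k) M) ν') * (u' (kingSec M L k m x + t • unitVec (fine (L ^ m * L ^ k) M) μ + s • unitVec (fine (L ^ m * L ^ k) M) κ' + s' • unitVec (fine (L ^ m * L ^ k) M) ν' + unitVec (fine (L ^ m * L ^ k) M) μ))ᴴ) (N := L ^ m) (κ := b) (fun s hs => by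
      have e1 : kingSec M L k m x + t • unitVec (fine (L ^ m * L ^ k) M) μ + (s + 1) • unitVec (fine (L ^ m * L ^ k) M) κ' + s' • unitVec (fine (L ^ m * L ^ k) M) ν' = kingSec M L k m x + t • unitVec (fine (L ^ m * L ^ k) M) μ + s • unitVec (fine (L ^ m * L ^ k) M) κ' + s' • unitVec (fine (L ^ m * L ^ k) M) ν' + unitVec (fine (L ^ m * L ^ k) M) κ' := by
        rw [succ_nsmul]; abel
      rw [norm_sub_rev, e1]; exact hstep _ (hQ t ht s hs.le s' hs') κ')
    rw [norm_sub_rev]; exact h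
  have mixed : ∀ t < L ^ m, ‖u' (kingSec M L k m x + t • unitVec (fine (L ^ m * L ^ k) M) μ + (L ^ m) • unitVec (fine (L ^ m * L ^ k) M) κ' + (L ^ m) • unitVec (fine (L ^ m * L ^ k) M) ν') * U' μ (kingSec M L k m x + t • unitVec (fine (L ^ m * L ^ k) M) μ + (L ^ m) • unitVec (fine (L ^ m * L ^ k) M) κ' + (L ^ m) • unitVec (fine (L ^ m * L ^ k) M) ν') * (u' (kingSec M L k m x + t • unitVec (fine (L ^ m * L ^ k) M) μ + (L ^ m) • unitVec (fine (L ^ m * L ^ k) M) κ' + (L ^ m) • unitVec (fine (L ^ m * L ^ k) M) ν' + unitVec (fine (L ^ m * L ^ k) M) μ))ᴴ - u' (kingSec M L k m x + t • unitVec (fine (L ^ m * L ^ k) M) μ + (L ^ m) • unitVec (fine (L ^ m * L ^ k) M) κ') * U' μ (kingSec M L k m x + t • unitVec (fine (L ^ m * L ^ k) M) μ + (L ^ m) • unitVec (fine (L ^ m * L ^ k) M) κ') * (u' (kingSec M L k m x + t • unitVec (fine (L ^ m * L ^ k) M) μ + (L ^ m) • unitVec (fine (L ^ m * L ^ k) M)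 κ' + unitVec (fine (L ^ m * L ^ k) M) μ))ᴴ -
      u' (kingSec M L k m x + t • unitVec (fine (L ^ m * L ^ k) M) μ + (L ^ m) • unitVec (fine (L ^ m * L ^ k) M) ν') * U' μ (kingSec M L k m x + t • unitVec (fine (L ^ m * L ^ k) M) μ + (L ^ m) • unitVec (fine (L ^ m * L ^ k) M) ν') * (u' (kingSec M L k m x + t • unitVec (fine (L ^ m * L ^ k) M) μ + (L ^ m) • unitVec (fine (L ^ m * L ^ k) M) ν' + unitVec (fine (L ^ m * L ^ k) M) μ))ᴴ + u' (kingSec M L k m x + t • unitVec (fine (L ^ m * L ^ k) M) μ) * U' μ (kingSec M L k m x + t • unitVec (fine (L ^ m * L ^ k) M) μ) * (u' (kingSec M L k m x + t • unitVec (fine (L ^ m * L ^ k) M) μ + unitVec (fine (L ^ m * L ^ k) M) μ))ᴴ‖ ≤ ((L ^ m : ℕ) : ℝ) ^ 2 * c₂ := fun t ht =>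
    norm_mixedDiff_le_of_steps (fun z => u' (z) * U' μ (z) * (u' (z + unitVec (fine (L ^ m * L ^ k) M) μ))ᴴ) (kingSec M L k m x + t • unitVec (fine (L ^ m * L ^ k) M) μ) (unitVec (fine (L ^ m * L ^ k) M) κ') (unitVec (fine (L ^ m * L ^ k) M) ν') (fun s hs s' hs' => hsecond _ (hQ t ht s hs.le s' hs'.le) κ' ν')
  refine (norm_gauged_lineHol_mixedDiff_le M L k m hu' hU' (mul_nonneg hN0 hb) (mul_nonneg hN0 hb) μ κ' ν' x
    (δ₂ := ((L ^ m : ℕ) : ℝ) ^ 2 * c₂) (fun t ht => ⟨chainν t ht (L ^ m) le_rfl, ?_, ?_, ?_, mixed t ht⟩)).trans (le_of_eq (by ring))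
  · have h := chainν t ht 0 (Nat.zero_le _); simpa only [zero_smul, add_zero] using h
  · have h := chainκ t ht (L ^ m) le_rfl; simpa only [zero_smul, add_zero] using h
  · have h := chainκ t ht 0 (Nat.zero_le _); simpa only [zero_smul, add_zero] using h

end Pairing

end Summit.QuantumFields.YangMills.BalabanUVNodes.N15.CovAvg

end
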